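import Summits.QuantumFields.YangMills.Theorems.AllWindowsColdBoxLineGaussToolkit
import Summits.QuantumFields.YangMills.Theorems.WeakCouplingRatesColdBoxDirichletRestrictedCov
import Mathlib.Probability.Moments.Covariance
import HarnessLib

/-!
# LINE-17 «hypercontractive second-order tilt expansion» on crux `AllWindowsColdBox.BoxMidWindowsSU22` (stmt-QuantumFields-24003):
# F(ii) of stub F `stub_gaussSideTerms` — the covariance transfer / decomposition engine (STUB-PLAN-E §5 F(ii))

`GaussSideTerms θ` (ii) asks, eventually in `β` and uniformly in `T ≤ ⌈β^θ⌉`, for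
`|Cov_ν(f, g_T) − ¾·boxDirCircSqCov ⌈β^θ⌉ T| ≤ K⌈β^θ⌉⁶/β` (`ν = lineGauss θ β`).  This file proves the ABSTRACT engine
**`abs_cov_lineGauss_sub_cov_gaussD_le`**: for two bounded observables `f, g` which, on the conditioning event, decompose as
`f = q_f − c_f − ρ_f`, `|ρ_f| ≤ r_f` (E(0) Taylor: even quadratic surrogate `q`, odd local cubic term `c`, quartic remainder `r`), with
Gaussian moment inputs `∫q⁴dγ ≤ A4`, `∫c⁴dγ ≤ min(1, Cc4·S⁶/β²)`, `∫r²dγ ≤ Cr2·S⁴/β²` (`S = 16⌈β^θ⌉`), one has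
`|Cov_ν(f,g) − Cov_γ(q_f,q_g)| ≤ K₀(A4,Cc4,Cr2)·S⁴/β`.  The instantiation (`q = qObsD`, `Cov_γ(q_f,q_g) = (D/4)·boxDirCircSqCov` by
`cov_qObsD_gaussD_eq`, `D = dimE ρ₂ = 3`) is F(ii) proper and lives with the F assembly.

Ingredients: Mathlib's `covariance` bilinearity (the nine-term expansion `cov_decomposition_expand`), the toolkit's covariance transfer
`γ → ν` at `k = 2` (`eventually_abs_cov_gaussD_sub_cov_lineGauss_le`), parity (`integral_gaussD_even_mul_odd`: the `q·c` cross
covariances vanish under `γ`), weighted AM–GM for the `ρ`-terms (`abs_cov_le_amgm` with weight `β^{∓1}`), `∫·dν ≤ 2∫·dγ`, and the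
real-arithmetic `covariance_bookkeeping`.  No definition; standard axioms.

HONEST LABEL: a helper toward one third of the OPEN registered stub F of one critic-PASSed line on the R2ξ″ RECORD-rung crux 24003;
no stub by name, no crux, rung or summit; the Yang–Mills mass gap is NOT proved by this file.
-/

set_option autoImplicit false

noncomputable section

open MeasureTheory ProbabilityTheory Finset
open Literature.MathematicalPhysics.QuantumLattice
open Literature.MathematicalPhysics.QuantumFieldTheory
open Literature.MathematicalPhysics.QuantumFieldTheory.LatticeMaxwell
open Summit.QuantumFields.YangMills.Theorems.WeakCouplingRates
open Summit.QuantumFields.YangMills.Theorems.ColdBoxAllGroups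
open Summit.QuantumFields.YangMills.Theorems.FreeEnergyLogCoefficient

namespace Summit.QuantumFields.YangMills.Theorems.AllWindowsColdBoxBoxMidLine

section Generic

variable {Ω : Type*} [MeasurableSpace Ω] {μ : Measure Ω}

/-- Weighted AM–GM: `|u v| ≤ (l u² + l⁻¹ v²)/2` for `l > 0`. -/
theorem abs_mul_le_amgm (u v : ℝ) {l : ℝ} (hl : 0 < l) : |u * v| ≤ (l * u ^ 2 + l⁻¹ * v ^ 2) / 2 := by
  rw [abs_mul]
  have h : 2 * l * (|u| * |v|) ≤ l ^ 2 * u ^ 2 + v ^ 2 := by nlinarith [sq_nonneg (l * |u| - |v|), sq_abs u, sq_abs v]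
  have hl' : l⁻¹ * v ^ 2 = v ^ 2 / l := by rw [inv_mul_eq_div]
  rw [hl', le_div_iff₀ (by norm_num : (0:ℝ) < 2)]
  have : l * u ^ 2 + v ^ 2 / l = (l ^ 2 * u ^ 2 + v ^ 2) / l := by field_simp
  rw [this, le_div_iff₀ hl]
  linarith

/-- Pointwise AM–GM for a square against a fourth power: `c² ≤ (l + l⁻¹ c⁴)/2` for `l > 0`. -/
theorem sq_le_amgm_pow_four (c : ℝ) {l : ℝ} (hl : 0 < l) : c ^ 2 ≤ (l + l⁻¹ * c ^ 4) / 2 := by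
  have h := abs_mul_le_amgm 1 (c ^ 2) hl
  rw [one_mul, one_pow, mul_one, abs_of_nonneg (sq_nonneg c)] at h
  calc c ^ 2 ≤ (l + l⁻¹ * (c ^ 2) ^ 2) / 2 := h
    _ = (l + l⁻¹ * c ^ 4) / 2 := by ring

/-- **Weighted AM–GM bound for a covariance** on a probability space: `|Cov(X,Y)| ≤ (l ∫X² + l⁻¹ ∫Y²)/2` for `l > 0`
(`|∫ X̃ Ỹ| ≤ ∫ (l X̃² + l⁻¹ Ỹ²)/2 = (l Var X + l⁻¹ Var Y)/2` and `Var ≤` second moment). -/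
theorem abs_cov_le_amgm [IsProbabilityMeasure μ] {X Y : Ω → ℝ} (hX : MemLp X 2 μ) (hY : MemLp Y 2 μ) {l : ℝ} (hl : 0 < l) :
    |cov[X, Y; μ]| ≤ (l * ∫ ω, X ω ^ 2 ∂μ + l⁻¹ * ∫ ω, Y ω ^ 2 ∂μ) / 2 := by
  have hXc : MemLp (fun ω => X ω - μ[X]) 2 μ := hX.sub (memLp_const _)
  have hYc : MemLp (fun ω => Y ω - μ[Y]) 2 μ := hY.sub (memLp_const _)
  have hiX : Integrable (fun ω => (X ω - μ[X]) ^ 2) μ := hXc.integrable_sq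
  have hiY : Integrable (fun ω => (Y ω - μ[Y]) ^ 2) μ := hYc.integrable_sq
  have h1 : |cov[X, Y; μ]| ≤ ∫ ω, (l * (X ω - μ[X]) ^ 2 + l⁻¹ * (Y ω - μ[Y]) ^ 2) / 2 ∂μ := by
    unfold covariance
    refine (abs_integral_le_integral_abs).trans (integral_mono_of_nonneg (ae_of_all _ fun ω => abs_nonneg _)
      (((hiX.const_mul l).add (hiY.const_mul l⁻¹)).div_const 2) (ae_of_all _ fun ω => abs_mul_le_amgm _ _ hl))
  have h2 : ∫ ω, (l * (X ω - μ[X]) ^ 2 + l⁻¹ * (Y ω - μ[Y]) ^ 2) / 2 ∂μ =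
      (l * ∫ ω, (X ω - μ[X]) ^ 2 ∂μ + l⁻¹ * ∫ ω, (Y ω - μ[Y]) ^ 2 ∂μ) / 2 := by
    rw [integral_div, integral_add (hiX.const_mul l) (hiY.const_mul l⁻¹), integral_const_mul, integral_const_mul]
  have hvX : ∫ ω, (X ω - μ[X]) ^ 2 ∂μ ≤ ∫ ω, X ω ^ 2 ∂μ := by
    have e : ∫ ω, (X ω - μ[X]) ^ 2 ∂μ = Var[X; μ] := (variance_eq_integral hX.aestronglyMeasurable.aemeasurable).symm
    rw [e]
    exact (variance_le_expectation_sq hX.aestronglyMeasurable).trans (le_of_eq rfl)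
  have hvY : ∫ ω, (Y ω - μ[Y]) ^ 2 ∂μ ≤ ∫ ω, Y ω ^ 2 ∂μ := by
    have e : ∫ ω, (Y ω - μ[Y]) ^ 2 ∂μ = Var[Y; μ] := (variance_eq_integral hY.aestronglyMeasurable.aemeasurable).symm
    rw [e]
    exact (variance_le_expectation_sq hY.aestronglyMeasurable).trans (le_of_eq rfl)
  rw [h2] at h1
  refine h1.trans ?_
  have hl0 : 0 ≤ l := hl.le
  have hli : 0 ≤ l⁻¹ := inv_nonneg.2 hl0
  nlinarith [mul_le_mul_of_nonneg_left hvX hl0, mul_le_mul_of_nonneg_left hvY hli]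

/-- **The nine-term expansion** of `Cov(q₁ − c₁ − ρ₁, q₂ − c₂ − ρ₂)` used by F(ii) (grouping `u = q − c` against `ρ`). -/
theorem cov_decomposition_expand [IsProbabilityMeasure μ] {q₁ c₁ r₁ q₂ c₂ r₂ : Ω → ℝ} (hq₁ : MemLp q₁ 2 μ) (hc₁ : MemLp c₁ 2 μ)
    (hr₁ : MemLp r₁ 2 μ) (hq₂ : MemLp q₂ 2 μ) (hc₂ : MemLp c₂ 2 μ) (hr₂ : MemLp r₂ 2 μ) :
    cov[fun ω => q₁ ω - c₁ ω - r₁ ω, fun ω => q₂ ω - c₂ ω - r₂ ω; μ] =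
      cov[q₁, q₂; μ] - cov[q₁, c₂; μ] - cov[c₁, q₂; μ] + cov[c₁, c₂; μ] -
        cov[fun ω => q₁ ω - c₁ ω, r₂; μ] - cov[r₁, fun ω => q₂ ω - c₂ ω; μ] + cov[r₁, r₂; μ] := by
  have e1 := covariance_fun_sub_fun_sub (μ := μ) (X := fun ω => q₁ ω - c₁ ω) (Y := r₁) (Z := fun ω => q₂ ω - c₂ ω) (T := r₂)
    (hq₁.sub hc₁) hr₁ (hq₂.sub hc₂) hr₂
  have e2 := covariance_fun_sub_fun_sub (μ := μ) hq₁ hc₁ hq₂ hc₂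
  rw [e1, e2]

/-- Triangle inequality for the seven-term combination of `cov_decomposition_expand` against a main value `M`. -/
theorem abs_comb7_sub_le (a b c d e f g M : ℝ) :
    |a - b - c + d - e - f + g - M| ≤ |a - M| + |b| + |c| + |d| + |e| + |f| + |g| := by
  have h1 := abs_add_le (a - M) (-b)
  have h2 := abs_add_le (a - M + -b) (-c)
  have h3 := abs_add_le (a - M + -b + -c) d
  have h4 := abs_add_le (a - M + -b + -c + d) (-e)
  have h5 := abs_add_le (a - M + -b + -c + d + -e) (-f)
  have h6 := abs_add_le (a - M + -b + -c + d + -e + -f) g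
  rw [abs_neg] at h1 h2 h4 h5
  have e : a - b - c + d - e - f + g - M = a - M + -b + -c + d + -e + -f + g := by ring
  rw [e]
  linarith

/-- `∫ (X − Y)² ≤ 2(∫ X² + ∫ Y²)` for `X, Y ∈ L²`. -/
theorem integral_sub_sq_le_two_mul {X Y : Ω → ℝ} (hX : MemLp X 2 μ) (hY : MemLp Y 2 μ) :
    ∫ ω, (X ω - Y ω) ^ 2 ∂μ ≤ 2 * ((∫ ω, X ω ^ 2 ∂μ) + ∫ ω, Y ω ^ 2 ∂μ) := by
  have hX2 : Integrable (fun ω => X ω ^ 2) μ := hX.integrable_sq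
  have hY2 : Integrable (fun ω => Y ω ^ 2) μ := hY.integrable_sq
  have hS : Integrable (fun ω => X ω ^ 2 + Y ω ^ 2) μ := hX2.add hY2
  have hR : Integrable (fun ω => 2 * (X ω ^ 2 + Y ω ^ 2)) μ := hS.const_mul 2
  have hL : Integrable (fun ω => (X ω - Y ω) ^ 2) μ := (hX.sub hY).integrable_sq
  refine (integral_mono hL hR fun ω => ?_).trans (le_of_eq ?_)
  · change (X ω - Y ω) ^ 2 ≤ 2 * (X ω ^ 2 + Y ω ^ 2); nlinarith [sq_nonneg (X ω + Y ω)]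
  · rw [integral_const_mul, integral_add hX2 hY2]

/-- `∫ c² ≤ (l + l⁻¹ ∫ c⁴)/2` on a probability space (`l > 0`), from the pointwise AM–GM `sq_le_amgm_pow_four`. -/
theorem integral_sq_le_amgm [IsProbabilityMeasure μ] {c : Ω → ℝ} (hc : MemLp c 2 μ) (hc4 : Integrable (fun ω => c ω ^ 4) μ) {l : ℝ}
    (hl : 0 < l) : ∫ ω, c ω ^ 2 ∂μ ≤ (l + l⁻¹ * ∫ ω, c ω ^ 4 ∂μ) / 2 := by
  have h4 : Integrable (fun ω => l⁻¹ * c ω ^ 4) μ := hc4.const_mul _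
  have hS : Integrable (fun ω => l + l⁻¹ * c ω ^ 4) μ := (integrable_const l).add h4
  have hR : Integrable (fun ω => (l + l⁻¹ * c ω ^ 4) / 2) μ := hS.div_const 2
  refine (integral_mono hc.integrable_sq hR fun ω => sq_le_amgm_pow_four (c ω) hl).trans (le_of_eq ?_)
  rw [integral_div, integral_add (integrable_const l) h4, integral_const, integral_const_mul, probReal_univ, one_smul]

/-- `∫ ρ² ≤ ∫ r²` when `|ρ| ≤ r` almost everywhere. -/
theorem integral_sq_le_of_abs_le_ae {ρ r : Ω → ℝ} (hρ : MemLp ρ 2 μ) (hr : Integrable (fun ω => r ω ^ 2) μ)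
    (h : ∀ᵐ ω ∂μ, |ρ ω| ≤ r ω) : ∫ ω, ρ ω ^ 2 ∂μ ≤ ∫ ω, r ω ^ 2 ∂μ := by
  refine integral_mono_ae hρ.integrable_sq hr (h.mono fun ω hω => ?_)
  calc ρ ω ^ 2 = |ρ ω| ^ 2 := (sq_abs _).symm
    _ ≤ r ω ^ 2 := pow_le_pow_left₀ (abs_nonneg _) hω 2

/-- Pure bookkeeping of F(ii): the seven error terms against the constants (`S = 16H ≥ 1`, `β ≥ 1`; `P4, P2` = fourth / second
Gaussian moments of the quadratic surrogates, `C4, C2` of the cubic terms, `Q, X, Y, U, R` = the `ν`-moments `∫q², ∫c², ∫c⁴, ∫(q−c)², ∫ρ²`). -/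
theorem covariance_bookkeeping {β S A4 Cc4 Cr2 P4f P4g P2f P2g C4f C4g C2f C2g Qf Qg Xf Xg Yf Yg Uf Ug Rf Rg T1 T2 T3 T4 T5 T6 T7 : ℝ}
    (hβ : 1 ≤ β) (hS : 1 ≤ S) (hA4 : 0 ≤ A4) (hCc4 : 0 ≤ Cc4) (hCr2 : 0 ≤ Cr2)
    (hP4f : P4f ≤ A4) (hP4g : P4g ≤ A4)
    (hP2f : P2f ≤ (1 + P4f) / 2) (hP2g0 : 0 ≤ P2g) (hP2g : P2g ≤ (1 + P4g) / 2)
    (hC4f : C4f ≤ 1) (hC4g : C4g ≤ 1)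
    (hC2f : C2f ≤ (1 + C4f) / 2) (hC2g0 : 0 ≤ C2g) (hC2g : C2g ≤ (1 + C4g) / 2)
    (hQf : Qf ≤ 2 * P2f) (hQg : Qg ≤ 2 * P2g) (hXf0 : 0 ≤ Xf) (hXg0 : 0 ≤ Xg)
    (hXf : Xf ≤ (S ^ 3 / β + (S ^ 3 / β)⁻¹ * Yf) / 2) (hXg : Xg ≤ (S ^ 3 / β + (S ^ 3 / β)⁻¹ * Yg) / 2)
    (hYf : Yf ≤ 2 * (Cc4 * S ^ 6 / β ^ 2)) (hYg : Yg ≤ 2 * (Cc4 * S ^ 6 / β ^ 2))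
    (hUf : Uf ≤ 2 * (Qf + Xf)) (hUg : Ug ≤ 2 * (Qg + Xg))
    (hRf : Rf ≤ 2 * (Cr2 * S ^ 4 / β ^ 2)) (hRg : Rg ≤ 2 * (Cr2 * S ^ 4 / β ^ 2))
    (h1 : T1 ≤ (2 + P4f + P4g + 6 * (1 + P2f) * (1 + P2g)) * (1 / β))
    (h2 : T2 ≤ (2 + P4f + C4g + 6 * (1 + P2f) * (1 + C2g)) * (1 / β))
    (h3 : T3 ≤ (2 + C4f + P4g + 6 * (1 + C2f) * (1 + P2g)) * (1 / β))
    (h4 : T4 ≤ (1 * Xf + 1⁻¹ * Xg) / 2) (h5 : T5 ≤ (β⁻¹ * Uf + β⁻¹⁻¹ * Rg) / 2) (h6 : T6 ≤ (β * Rf + β⁻¹ * Ug) / 2)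
    (h7 : T7 ≤ (1 * Rf + 1⁻¹ * Rg) / 2) :
    T1 + T2 + T3 + T4 + T5 + T6 + T7 ≤
      ((2 + 2 * A4 + 6 * (1 + (1 + A4) / 2) ^ 2) + 2 * (3 + A4 + 12 * (1 + (1 + A4) / 2)) + 3 * (1 / 2 + Cc4) +
        4 * ((1 + A4) / 2) + 4 * Cr2) * (S ^ 4 / β) := by
  have hβ0 : 0 < β := by linarith
  have hS0 : 0 < S := by linarith
  rw [inv_inv] at h5
  rw [inv_one, one_mul, one_mul] at h4 h7
  -- the two units `u = 1/β ≤ w = S⁴/β`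
  have hu0 : 0 < 1 / β := by positivity
  have hu1 : 1 / β ≤ 1 := by rw [div_le_one hβ0]; exact hβ
  have hS4 : 1 ≤ S ^ 4 := one_le_pow₀ hS
  have hw0 : 0 ≤ S ^ 4 / β := by positivity
  have huw : 1 / β ≤ S ^ 4 / β := div_le_div_of_nonneg_right hS4 hβ0.le
  have hbi : β⁻¹ = 1 / β := inv_eq_one_div β
  rw [hbi] at h5 h6
  -- `S³/β ≤ w`, `S⁴/β² ≤ w·(1/β) ≤ w`
  have h3w : S ^ 3 / β ≤ S ^ 4 / β := div_le_div_of_nonneg_right (pow_le_pow_right₀ hS (by norm_num)) hβ0.le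
  have h42 : S ^ 4 / β ^ 2 ≤ S ^ 4 / β := by
    rw [show S ^ 4 / β ^ 2 = S ^ 4 / β * (1 / β) by field_simp]
    exact mul_le_of_le_one_right hw0 hu1
  -- second moments of `q`: `P2 ≤ A2 := (1 + A4)/2`
  have hA2f : P2f ≤ (1 + A4) / 2 := hP2f.trans (by linarith)
  have hA2g : P2g ≤ (1 + A4) / 2 := hP2g.trans (by linarith)
  have hC2f1 : C2f ≤ 1 := hC2f.trans (by linarith)
  have hC2g1 : C2g ≤ 1 := hC2g.trans (by linarith)
  -- T1, T2, T3
  have hm1 : (1 + P2f) * (1 + P2g) ≤ (1 + (1 + A4) / 2) * (1 + (1 + A4) / 2) :=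
    mul_le_mul (by linarith only [hA2f]) (by linarith only [hA2g]) (by linarith only [hP2g0]) (by linarith only [hA4])
  have hm2 : (1 + P2f) * (1 + C2g) ≤ (1 + (1 + A4) / 2) * (1 + 1) :=
    mul_le_mul (by linarith only [hA2f]) (by linarith only [hC2g1]) (by linarith only [hC2g0]) (by linarith only [hA4])
  have hm3 : (1 + C2f) * (1 + P2g) ≤ (1 + 1) * (1 + (1 + A4) / 2) :=
    mul_le_mul (by linarith only [hC2f1]) (by linarith only [hA2g]) (by linarith only [hP2g0]) (by norm_num)
  have hc1 : 2 + P4f + P4g + 6 * (1 + P2f) * (1 + P2g) ≤ 2 + 2 * A4 + 6 * (1 + (1 + A4) / 2) ^ 2 := by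
    have e : 6 * (1 + P2f) * (1 + P2g) = 6 * ((1 + P2f) * (1 + P2g)) := by ring
    rw [e, sq]; linarith only [hm1, hP4f, hP4g]
  have hc2 : 2 + P4f + C4g + 6 * (1 + P2f) * (1 + C2g) ≤ 3 + A4 + 12 * (1 + (1 + A4) / 2) := by
    have e : 6 * (1 + P2f) * (1 + C2g) = 6 * ((1 + P2f) * (1 + C2g)) := by ring
    rw [e]; linarith only [hm2, hP4f, hC4g]
  have hc3 : 2 + C4f + P4g + 6 * (1 + C2f) * (1 + P2g) ≤ 3 + A4 + 12 * (1 + (1 + A4) / 2) := by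
    have e : 6 * (1 + C2f) * (1 + P2g) = 6 * ((1 + C2f) * (1 + P2g)) := by ring
    rw [e]; linarith only [hm3, hC4f, hP4g]
  have hk1 : (0 : ℝ) ≤ 2 + 2 * A4 + 6 * (1 + (1 + A4) / 2) ^ 2 := by positivity
  have hk2 : (0 : ℝ) ≤ 3 + A4 + 12 * (1 + (1 + A4) / 2) := by positivity
  have hT1 : T1 ≤ (2 + 2 * A4 + 6 * (1 + (1 + A4) / 2) ^ 2) * (S ^ 4 / β) :=
    h1.trans ((mul_le_mul_of_nonneg_right hc1 hu0.le).trans (mul_le_mul_of_nonneg_left huw hk1))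
  have hT2 : T2 ≤ (3 + A4 + 12 * (1 + (1 + A4) / 2)) * (S ^ 4 / β) :=
    h2.trans ((mul_le_mul_of_nonneg_right hc2 hu0.le).trans (mul_le_mul_of_nonneg_left huw hk2))
  have hT3 : T3 ≤ (3 + A4 + 12 * (1 + (1 + A4) / 2)) * (S ^ 4 / β) :=
    h3.trans ((mul_le_mul_of_nonneg_right hc3 hu0.le).trans (mul_le_mul_of_nonneg_left huw hk2))
  -- `X ≤ (S³/β)(1/2 + Cc4) ≤ w (1/2 + Cc4)`
  have hl0 : 0 < S ^ 3 / β := by positivity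
  have hCc : (0 : ℝ) ≤ 1 / 2 + Cc4 := by positivity
  have el : (S ^ 3 / β)⁻¹ * (2 * (Cc4 * S ^ 6 / β ^ 2)) = 2 * Cc4 * (S ^ 3 / β) := by field_simp
  have hXf' : Xf ≤ S ^ 4 / β * (1 / 2 + Cc4) := by
    have h' : (S ^ 3 / β)⁻¹ * Yf ≤ 2 * Cc4 * (S ^ 3 / β) := by rw [← el]; exact mul_le_mul_of_nonneg_left hYf (inv_nonneg.2 hl0.le)
    have : Xf ≤ S ^ 3 / β * (1 / 2 + Cc4) := by linarith only [hXf, h']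
    exact this.trans (mul_le_mul_of_nonneg_right h3w hCc)
  have hXg' : Xg ≤ S ^ 4 / β * (1 / 2 + Cc4) := by
    have h' : (S ^ 3 / β)⁻¹ * Yg ≤ 2 * Cc4 * (S ^ 3 / β) := by rw [← el]; exact mul_le_mul_of_nonneg_left hYg (inv_nonneg.2 hl0.le)
    have : Xg ≤ S ^ 3 / β * (1 / 2 + Cc4) := by linarith only [hXg, h']
    exact this.trans (mul_le_mul_of_nonneg_right h3w hCc)
  have hT4 : T4 ≤ S ^ 4 / β * (1 / 2 + Cc4) := by linarith only [h4, hXf', hXg']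
  -- `R ≤ 2 Cr2 S⁴/β² ≤ 2 Cr2 w`, `β R ≤ 2 Cr2 w`
  have hRw : 2 * (Cr2 * S ^ 4 / β ^ 2) ≤ 2 * Cr2 * (S ^ 4 / β) := by
    rw [show 2 * (Cr2 * S ^ 4 / β ^ 2) = 2 * Cr2 * (S ^ 4 / β ^ 2) by ring]
    exact mul_le_mul_of_nonneg_left h42 (by positivity)
  have eR : β * (2 * (Cr2 * S ^ 4 / β ^ 2)) = 2 * Cr2 * (S ^ 4 / β) := by field_simp
  have hβRf : β * Rf ≤ 2 * Cr2 * (S ^ 4 / β) := by rw [← eR]; exact mul_le_mul_of_nonneg_left hRf hβ0.le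
  have hβRg : β * Rg ≤ 2 * Cr2 * (S ^ 4 / β) := by rw [← eR]; exact mul_le_mul_of_nonneg_left hRg hβ0.le
  have hT7 : T7 ≤ 2 * Cr2 * (S ^ 4 / β) := by linarith only [h7, hRf, hRg, hRw]
  -- T5, T6: `(1/β) U ≤ (1/β)(4 A2 + 2 X) ≤ 4 A2 (1/β) + 2 X`
  have hUf' : 1 / β * Uf ≤ 4 * ((1 + A4) / 2) * (1 / β) + 2 * Xf := by
    have hU : Uf ≤ 4 * ((1 + A4) / 2) + 2 * Xf := by linarith only [hUf, hQf, hA2f]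
    have h' := mul_le_mul_of_nonneg_left hU hu0.le
    have hx : 1 / β * (2 * Xf) ≤ 2 * Xf := mul_le_of_le_one_left (by positivity) hu1
    linarith only [h', hx]
  have hUg' : 1 / β * Ug ≤ 4 * ((1 + A4) / 2) * (1 / β) + 2 * Xg := by
    have hU : Ug ≤ 4 * ((1 + A4) / 2) + 2 * Xg := by linarith only [hUg, hQg, hA2g]
    have h' := mul_le_mul_of_nonneg_left hU hu0.le
    have hx : 1 / β * (2 * Xg) ≤ 2 * Xg := mul_le_of_le_one_left (by positivity) hu1
    linarith only [h', hx]
  have hA2u : 4 * ((1 + A4) / 2) * (1 / β) ≤ 4 * ((1 + A4) / 2) * (S ^ 4 / β) := mul_le_mul_of_nonneg_left huw (by positivity)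
  have hT5 : T5 ≤ 2 * ((1 + A4) / 2) * (S ^ 4 / β) + S ^ 4 / β * (1 / 2 + Cc4) + Cr2 * (S ^ 4 / β) := by
    linarith only [h5, hUf', hβRg, hXf', hA2u]
  have hT6 : T6 ≤ 2 * ((1 + A4) / 2) * (S ^ 4 / β) + S ^ 4 / β * (1 / 2 + Cc4) + Cr2 * (S ^ 4 / β) := by
    linarith only [h6, hUg', hβRf, hXg', hA2u]
  linarith only [hT1, hT2, hT3, hT4, hT5, hT6, hT7]

end Generic

section Transfer

/-- **The abstract covariance estimate of F(ii)** (`0 < θ ≤ 1/16`, eventually in `β`; `H = ⌈β^θ⌉`, `γ = gaussD H D`, `ν = lineGauss θ β`,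
`S = 16H`).  Two bounded observables `f, g` that decompose ON THE EVENT as `f = q_f − c_f − ρ_f` with `|ρ_f| ≤ r_f` (and likewise `g`),
where the quadratic surrogates `q` are even with `∫q⁴dγ ≤ A4`, the cubic terms `c` are odd with `∫c⁴dγ ≤ 1` and `≤ Cc4·S⁶/β²`, and the
remainders have `∫r²dγ ≤ Cr2·S⁴/β²`, satisfy `|Cov_ν(f,g) − Cov_γ(q_f,q_g)| ≤ K₀·S⁴/β` with
`K₀ = (2 + 2A4 + 6(1+A2)²) + 2(3 + A4 + 12(1+A2)) + 3(1/2 + Cc4) + 4A2 + 4Cr2`, `A2 = (1+A4)/2`.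
Ingredients: the nine-term expansion, the covariance transfer `γ → ν` (`k = 2`), parity (`even·odd` has mean zero under `γ`),
weighted AM–GM for the `ρ`-terms, `∫·dν ≤ 2∫·dγ`. -/
theorem abs_cov_lineGauss_sub_cov_gaussD_le {θ : ℝ} (hθ : 0 < θ) (hθ16 : θ ≤ 1 / 16) {A4 Cc4 Cr2 : ℝ} (hA4 : 0 ≤ A4)
    (hCc4 : 0 ≤ Cc4) (hCr2 : 0 ≤ Cr2) :
    ∃ β₀ : ℝ, ∀ β : ℝ, β₀ ≤ β → ∀ (B : ℝ) (f g qf qg cf cg rf rg : TSpaceD ⌈β ^ θ⌉₊ (dimE ρ₂) → ℝ),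
      Measurable f → Measurable g → (∀ t, |f t| ≤ B) → (∀ t, |g t| ≤ B) →
      Measurable qf → Measurable qg → (∀ t, qf (-t) = qf t) → (∀ t, qg (-t) = qg t) →
      Integrable (fun t => qf t ^ 4) (gaussD ⌈β ^ θ⌉₊ (dimE ρ₂)) → Integrable (fun t => qg t ^ 4) (gaussD ⌈β ^ θ⌉₊ (dimE ρ₂)) →
      ∫ t, qf t ^ 4 ∂(gaussD ⌈β ^ θ⌉₊ (dimE ρ₂)) ≤ A4 → ∫ t, qg t ^ 4 ∂(gaussD ⌈β ^ θ⌉₊ (dimE ρ₂)) ≤ A4 →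
      AEStronglyMeasurable cf (gaussD ⌈β ^ θ⌉₊ (dimE ρ₂)) → AEStronglyMeasurable cg (gaussD ⌈β ^ θ⌉₊ (dimE ρ₂)) →
      (∀ t, cf (-t) = -cf t) → (∀ t, cg (-t) = -cg t) →
      Integrable (fun t => cf t ^ 4) (gaussD ⌈β ^ θ⌉₊ (dimE ρ₂)) → Integrable (fun t => cg t ^ 4) (gaussD ⌈β ^ θ⌉₊ (dimE ρ₂)) →
      ∫ t, cf t ^ 4 ∂(gaussD ⌈β ^ θ⌉₊ (dimE ρ₂)) ≤ 1 → ∫ t, cg t ^ 4 ∂(gaussD ⌈β ^ θ⌉₊ (dimE ρ₂)) ≤ 1 →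
      ∫ t, cf t ^ 4 ∂(gaussD ⌈β ^ θ⌉₊ (dimE ρ₂)) ≤ Cc4 * (16 * (⌈β ^ θ⌉₊ : ℝ)) ^ 6 / β ^ 2 →
      ∫ t, cg t ^ 4 ∂(gaussD ⌈β ^ θ⌉₊ (dimE ρ₂)) ≤ Cc4 * (16 * (⌈β ^ θ⌉₊ : ℝ)) ^ 6 / β ^ 2 →
      Integrable (fun t => rf t ^ 2) (gaussD ⌈β ^ θ⌉₊ (dimE ρ₂)) → Integrable (fun t => rg t ^ 2) (gaussD ⌈β ^ θ⌉₊ (dimE ρ₂)) →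
      ∫ t, rf t ^ 2 ∂(gaussD ⌈β ^ θ⌉₊ (dimE ρ₂)) ≤ Cr2 * (16 * (⌈β ^ θ⌉₊ : ℝ)) ^ 4 / β ^ 2 →
      ∫ t, rg t ^ 2 ∂(gaussD ⌈β ^ θ⌉₊ (dimE ρ₂)) ≤ Cr2 * (16 * (⌈β ^ θ⌉₊ : ℝ)) ^ 4 / β ^ 2 →
      (∀ t ∈ lineEvent θ β, |qf t - f t - cf t| ≤ rf t) → (∀ t ∈ lineEvent θ β, |qg t - g t - cg t| ≤ rg t) →
      |((∫ t, f t * g t ∂(lineGauss θ β)) - (∫ t, f t ∂(lineGauss θ β)) * (∫ t, g t ∂(lineGauss θ β))) -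
          ((∫ t, qf t * qg t ∂(gaussD ⌈β ^ θ⌉₊ (dimE ρ₂))) -
            (∫ t, qf t ∂(gaussD ⌈β ^ θ⌉₊ (dimE ρ₂))) * (∫ t, qg t ∂(gaussD ⌈β ^ θ⌉₊ (dimE ρ₂))))| ≤
        ((2 + 2 * A4 + 6 * (1 + (1 + A4) / 2) ^ 2) + 2 * (3 + A4 + 12 * (1 + (1 + A4) / 2)) + 3 * (1 / 2 + Cc4) +
          4 * ((1 + A4) / 2) + 4 * Cr2) * ((16 * (⌈β ^ θ⌉₊ : ℝ)) ^ 4 / β) := by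
  obtain ⟨β₁, hpack⟩ := eventually_lineGauss_package hθ hθ16 (k := 1) le_rfl
  obtain ⟨β₂, htr⟩ := eventually_abs_cov_gaussD_sub_cov_lineGauss_le hθ hθ16 (k := 2) (by norm_num)
  refine ⟨max β₁ β₂, fun β hβ B f g qf qg cf cg rf rg hfm hgm hfb hgb hqfm hqgm hqfe hqge hqf4 hqg4 hqf4le hqg4le hcfm hcgm hcfo hcgo
    hcf4 hcg4 hcf1 hcg1 hcf4le hcg4le hrf2 hrg2 hrf2le hrg2le hdf hdg => ?_⟩
  obtain ⟨hβ1, hνP, hγS, -, -, hhalf⟩ := hpack β ((le_max_left _ _).trans hβ)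
  have hβ2 : β₂ ≤ β := (le_max_right _ _).trans hβ
  have hβ0 : 0 < β := by linarith
  have hHr : (1 : ℝ) ≤ (⌈β ^ θ⌉₊ : ℝ) := (one_le_ceil_rpow_and_le hβ1 hθ.le).1
  have hS : (1 : ℝ) ≤ 16 * (⌈β ^ θ⌉₊ : ℝ) := by linarith
  haveI : IsProbabilityMeasure (gaussD ⌈β ^ θ⌉₊ (dimE ρ₂)) := isProbabilityMeasure_gaussD _ _
  haveI : IsProbabilityMeasure (lineGauss θ β) := hνP
  have hsq : Real.sqrt (1 / β ^ 2) = 1 / β := by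
    rw [show (1 : ℝ) / β ^ 2 = (1 / β) ^ 2 by ring]; exact Real.sqrt_sq (by positivity)
  -- second moments under `γ`
  obtain ⟨hqf2, hqf2le⟩ := memLp_two_of_integrable_pow_four hqfm.aestronglyMeasurable hqf4
  obtain ⟨hqg2, hqg2le⟩ := memLp_two_of_integrable_pow_four hqgm.aestronglyMeasurable hqg4
  obtain ⟨hcf2, hcf2le⟩ := memLp_two_of_integrable_pow_four hcfm hcf4
  obtain ⟨hcg2, hcg2le⟩ := memLp_two_of_integrable_pow_four hcgm hcg4
  have hP2g0 : 0 ≤ ∫ t, qg t ^ 2 ∂(gaussD ⌈β ^ θ⌉₊ (dimE ρ₂)) := integral_nonneg fun t => sq_nonneg _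
  have hC2g0 : 0 ≤ ∫ t, cg t ^ 2 ∂(gaussD ⌈β ^ θ⌉₊ (dimE ρ₂)) := integral_nonneg fun t => sq_nonneg _
  -- `L²(ν)`
  have hqf2ν : MemLp qf 2 (lineGauss θ β) := memLp_cond_of_memLp hγS hqf2
  have hqg2ν : MemLp qg 2 (lineGauss θ β) := memLp_cond_of_memLp hγS hqg2
  have hcf2ν : MemLp cf 2 (lineGauss θ β) := memLp_cond_of_memLp hγS hcf2
  have hcg2ν : MemLp cg 2 (lineGauss θ β) := memLp_cond_of_memLp hγS hcg2
  have hfν : MemLp f 2 (lineGauss θ β) :=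
    MemLp.of_bound hfm.aestronglyMeasurable B (ae_of_all _ fun t => by rw [Real.norm_eq_abs]; exact hfb t)
  have hgν : MemLp g 2 (lineGauss θ β) :=
    MemLp.of_bound hgm.aestronglyMeasurable B (ae_of_all _ fun t => by rw [Real.norm_eq_abs]; exact hgb t)
  obtain ⟨ρf, hρf⟩ : ∃ ρ : TSpaceD ⌈β ^ θ⌉₊ (dimE ρ₂) → ℝ, ρ = fun t => qf t - f t - cf t := ⟨_, rfl⟩
  obtain ⟨ρg, hρg⟩ : ∃ ρ : TSpaceD ⌈β ^ θ⌉₊ (dimE ρ₂) → ℝ, ρ = fun t => qg t - g t - cg t := ⟨_, rfl⟩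
  have hρfν : MemLp ρf 2 (lineGauss θ β) := by rw [hρf]; exact (hqf2ν.sub hfν).sub hcf2ν
  have hρgν : MemLp ρg 2 (lineGauss θ β) := by rw [hρg]; exact (hqg2ν.sub hgν).sub hcg2ν
  have ef : f = fun t => qf t - cf t - ρf t := by funext t; rw [hρf]; ring
  have eg : g = fun t => qg t - cg t - ρg t := by funext t; rw [hρg]; ring
  -- the expansion of `Cov_ν(f,g)`
  have hexp := cov_decomposition_expand (μ := lineGauss θ β) hqf2ν hcf2ν hρfν hqg2ν hcg2ν hρgν
  rw [← ef, ← eg] at hexp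
  have ecf : (∫ t, f t * g t ∂(lineGauss θ β)) - (∫ t, f t ∂(lineGauss θ β)) * (∫ t, g t ∂(lineGauss θ β)) =
      cov[f, g; lineGauss θ β] := by rw [covariance_eq_sub hfν hgν]; rfl
  have ecq : (∫ t, qf t * qg t ∂(lineGauss θ β)) - (∫ t, qf t ∂(lineGauss θ β)) * (∫ t, qg t ∂(lineGauss θ β)) =
      cov[qf, qg; lineGauss θ β] := by rw [covariance_eq_sub hqf2ν hqg2ν]; rfl
  have ecqc : (∫ t, qf t * cg t ∂(lineGauss θ β)) - (∫ t, qf t ∂(lineGauss θ β)) * (∫ t, cg t ∂(lineGauss θ β)) =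
      cov[qf, cg; lineGauss θ β] := by rw [covariance_eq_sub hqf2ν hcg2ν]; rfl
  have eccq : (∫ t, cf t * qg t ∂(lineGauss θ β)) - (∫ t, cf t ∂(lineGauss θ β)) * (∫ t, qg t ∂(lineGauss θ β)) =
      cov[cf, qg; lineGauss θ β] := by rw [covariance_eq_sub hcf2ν hqg2ν]; rfl
  -- T1: transfer of the main term
  have t1 := htr β hβ2 qf qg hqfm.aestronglyMeasurable hqgm.aestronglyMeasurable hqf4 hqg4
  rw [hsq, ecq, abs_sub_comm] at t1
  -- T2, T3: transfer + parity
  have t2 := htr β hβ2 qf cg hqfm.aestronglyMeasurable hcgm hqf4 hcg4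
  have z1 : ∫ t, qf t * cg t ∂(gaussD ⌈β ^ θ⌉₊ (dimE ρ₂)) = 0 := integral_gaussD_even_mul_odd _ _ hqfe hcgo
  have z2 : ∫ t, cg t ∂(gaussD ⌈β ^ θ⌉₊ (dimE ρ₂)) = 0 := integral_gaussD_eq_zero_of_odd _ _ hcgo
  rw [hsq, ecqc, z1, z2, mul_zero, sub_zero, zero_sub, abs_neg] at t2
  have t3 := htr β hβ2 cf qg hcfm hqgm.aestronglyMeasurable hcf4 hqg4
  have z3 : ∫ t, cf t * qg t ∂(gaussD ⌈β ^ θ⌉₊ (dimE ρ₂)) = 0 :=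
    integral_gaussD_eq_zero_of_odd _ _ fun t => by rw [hcfo, hqge, neg_mul]
  have z4 : ∫ t, cf t ∂(gaussD ⌈β ^ θ⌉₊ (dimE ρ₂)) = 0 := integral_gaussD_eq_zero_of_odd _ _ hcfo
  rw [hsq, eccq, z3, z4, zero_mul, sub_zero, zero_sub, abs_neg] at t3
  -- T4 … T7: weighted AM–GM
  have t4 := abs_cov_le_amgm hcf2ν hcg2ν one_pos
  have t5 : |cov[fun t => qf t - cf t, ρg; lineGauss θ β]| ≤
      (β⁻¹ * ∫ t, (qf t - cf t) ^ 2 ∂(lineGauss θ β) + β⁻¹⁻¹ * ∫ t, ρg t ^ 2 ∂(lineGauss θ β)) / 2 :=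
    abs_cov_le_amgm (hqf2ν.sub hcf2ν) hρgν (inv_pos.2 hβ0)
  have t6 : |cov[ρf, fun t => qg t - cg t; lineGauss θ β]| ≤
      (β * ∫ t, ρf t ^ 2 ∂(lineGauss θ β) + β⁻¹ * ∫ t, (qg t - cg t) ^ 2 ∂(lineGauss θ β)) / 2 :=
    abs_cov_le_amgm hρfν (hqg2ν.sub hcg2ν) hβ0
  have t7 := abs_cov_le_amgm hρfν hρgν one_pos
  -- `ν`-moments against `γ`-moments
  have hQf : ∫ t, qf t ^ 2 ∂(lineGauss θ β) ≤ 2 * ∫ t, qf t ^ 2 ∂(gaussD ⌈β ^ θ⌉₊ (dimE ρ₂)) :=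
    integral_cond_le_two_mul hhalf (ae_of_all _ fun t => sq_nonneg _) hqf2.integrable_sq
  have hQg : ∫ t, qg t ^ 2 ∂(lineGauss θ β) ≤ 2 * ∫ t, qg t ^ 2 ∂(gaussD ⌈β ^ θ⌉₊ (dimE ρ₂)) :=
    integral_cond_le_two_mul hhalf (ae_of_all _ fun t => sq_nonneg _) hqg2.integrable_sq
  have e4 : Even 4 := by decide
  have hYf : ∫ t, cf t ^ 4 ∂(lineGauss θ β) ≤ 2 * (Cc4 * (16 * (⌈β ^ θ⌉₊ : ℝ)) ^ 6 / β ^ 2) :=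
    (integral_cond_le_two_mul hhalf (ae_of_all _ fun t => e4.pow_nonneg _) hcf4).trans (by linarith only [hcf4le])
  have hYg : ∫ t, cg t ^ 4 ∂(lineGauss θ β) ≤ 2 * (Cc4 * (16 * (⌈β ^ θ⌉₊ : ℝ)) ^ 6 / β ^ 2) :=
    (integral_cond_le_two_mul hhalf (ae_of_all _ fun t => e4.pow_nonneg _) hcg4).trans (by linarith only [hcg4le])
  have hcf4ν : Integrable (fun t => cf t ^ 4) (lineGauss θ β) := integrable_cond_of_integrable hγS hcf4
  have hcg4ν : Integrable (fun t => cg t ^ 4) (lineGauss θ β) := integrable_cond_of_integrable hγS hcg4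
  have hl0 : 0 < (16 * (⌈β ^ θ⌉₊ : ℝ)) ^ 3 / β := by positivity
  have hXf := integral_sq_le_amgm hcf2ν hcf4ν hl0
  have hXg := integral_sq_le_amgm hcg2ν hcg4ν hl0
  have hXf0 : 0 ≤ ∫ t, cf t ^ 2 ∂(lineGauss θ β) := integral_nonneg fun t => sq_nonneg _
  have hXg0 : 0 ≤ ∫ t, cg t ^ 2 ∂(lineGauss θ β) := integral_nonneg fun t => sq_nonneg _
  have hUf := integral_sub_sq_le_two_mul hqf2ν hcf2ν
  have hUg := integral_sub_sq_le_two_mul hqg2ν hcg2ν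
  have haeE : ∀ᵐ t ∂(lineGauss θ β), t ∈ lineEvent θ β := ae_mem_lineEvent θ β
  have hrf2ν : Integrable (fun t => rf t ^ 2) (lineGauss θ β) := integrable_cond_of_integrable hγS hrf2
  have hrg2ν : Integrable (fun t => rg t ^ 2) (lineGauss θ β) := integrable_cond_of_integrable hγS hrg2
  have hRf : ∫ t, ρf t ^ 2 ∂(lineGauss θ β) ≤ 2 * (Cr2 * (16 * (⌈β ^ θ⌉₊ : ℝ)) ^ 4 / β ^ 2) := by
    have h1 : ∫ t, ρf t ^ 2 ∂(lineGauss θ β) ≤ ∫ t, rf t ^ 2 ∂(lineGauss θ β) :=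
      integral_sq_le_of_abs_le_ae hρfν hrf2ν (haeE.mono fun t ht => by rw [hρf]; exact hdf t ht)
    have h2 : ∫ t, rf t ^ 2 ∂(lineGauss θ β) ≤ 2 * ∫ t, rf t ^ 2 ∂(gaussD ⌈β ^ θ⌉₊ (dimE ρ₂)) :=
      integral_cond_le_two_mul hhalf (ae_of_all _ fun t => sq_nonneg _) hrf2
    linarith only [h1, h2, hrf2le]
  have hRg : ∫ t, ρg t ^ 2 ∂(lineGauss θ β) ≤ 2 * (Cr2 * (16 * (⌈β ^ θ⌉₊ : ℝ)) ^ 4 / β ^ 2) := by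
    have h1 : ∫ t, ρg t ^ 2 ∂(lineGauss θ β) ≤ ∫ t, rg t ^ 2 ∂(lineGauss θ β) :=
      integral_sq_le_of_abs_le_ae hρgν hrg2ν (haeE.mono fun t ht => by rw [hρg]; exact hdg t ht)
    have h2 : ∫ t, rg t ^ 2 ∂(lineGauss θ β) ≤ 2 * ∫ t, rg t ^ 2 ∂(gaussD ⌈β ^ θ⌉₊ (dimE ρ₂)) :=
      integral_cond_le_two_mul hhalf (ae_of_all _ fun t => sq_nonneg _) hrg2
    linarith only [h1, h2, hrg2le]
  -- bookkeeping
  have key := covariance_bookkeeping hβ1 hS hA4 hCc4 hCr2 hqf4le hqg4le hqf2le hP2g0 hqg2le hcf1 hcg1 hcf2le hC2g0 hcg2le hQf hQg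
    hXf0 hXg0 hXf hXg hYf hYg hUf hUg hRf hRg t1 t2 t3 t4 t5 t6 t7
  rw [ecf, hexp]
  exact (abs_comb7_sub_le _ _ _ _ _ _ _ _).trans key

end Transfer


end Summit.QuantumFields.YangMills.Theorems.AllWindowsColdBoxBoxMidLine

end
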